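import Summits.RiemannHypothesis.RiemannHypothesis.Theorems.OddSectorOddOneSignedWindowsImpliesRH
import Summits.RiemannHypothesis.RiemannHypothesis.Theorems.OddSectorOddOneSignedWindowsExistence
import Literature.NumberTheory.LFunctions.WeilOddGroundState
import HarnessLib

/-!
# Crux-strategist sketch, generation 1 — `OddSector.OddOneSignedWindows` (stmt-RiemannHypothesis-17778)

Typed companion of `STRATEGY-CENSUS.md` (gen 1, strategist seat
`planner-cstrat-stmt-RiemannHypothesis-17778-0`, 2026-08-17). No `sorry`; open statements are
`def … : Prop`. Generation 0's companion (`StrategistSketch.lean`: fold criterion, residue_iff,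
AllLargeWindowsGood, AllGroundStatesOneSigned, ¬RH → floor → ¬crux) stands; its fold pieces have
since LANDED (`goodWindow_of_noOpposedReflections` p150523,
`oddOneSignedWindows_iff_noOpposedReflections` p150975).

What is new in generation 1 is the LOGICAL STATUS of the crux, now kernel-checkable because the
odd Barta floor (stmt-17779) and the odd negativity (stmt-17780) are theorems and
`oddOneSignedWindows_imp_riemannHypothesis` has landed:

* `crux_iff_rh_and_conditional` — `S ↔ RH ∧ (RH → S)`: the crux is the summit conjoined with its
  own RH-conditional ("one-signed odd bottom states beyond every height UNDER RH", the judge's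
  key-risk statement);
* `not_rh_imp_crux_iff_rh` — `(¬RH → S) ↔ RH`: the route's deciding theorem `closes` uses `S` only
  after assuming `¬RH`, so the route consumes EXACTLY the first conjunct; the conditional conjunct
  is route-irrelevant (and irrefutable short of RH: `rh_of_not_conditional`);
* `stub_imp_rh` / `last_stub_imp_rh` — every concluding skeleton `T₁ → … → T_k → S` whose other
  stubs are proved leaves a stub that implies RH BY ITSELF: no line can park the summit-strength
  content anywhere but in one stub, so lines for this crux differ only in the MECHANISM their
  RH-strength stub invites, never in strength.

§2 types the two new census signatures that are statements about the tree's objects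
(`ClusterOneSignedVector`, S7; `EdgeTracePositive`, N7/D6) with their status in the docstrings.
-/

noncomputable section

set_option linter.dupNamespace false

open MeasureTheory Set Filter
open scoped Topology

namespace Summit.RiemannHypothesis.RiemannHypothesis.Cruxes.OddOneSignedWindows.Strategist2

open Literature.NumberTheory.LFunctions
open Summit.RiemannHypothesis.RiemannHypothesis.Theses.OddSector
open Summit.RiemannHypothesis.RiemannHypothesis.Theorems.OddSector

/-! ## 1. Logical status of the crux (kernel-checked) -/

/-- **D5. The crux is the summit plus its own RH-conditional.** `S ↔ RH ∧ (RH → S)`, from the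
landed `oddOneSignedWindows_imp_riemannHypothesis` (floor + Yoshida negativity, both RH-free
theorems of the tree). The second conjunct — one-signed odd bottom states at unboundedly many
windows GIVEN RH — is the beyond-summit content of the crux (not known to follow from RH: 2001
results §"What is not proved"; judge key_risk). [folklore] -/
theorem crux_iff_rh_and_conditional :
    OddOneSignedWindows ↔
      (_root_.RiemannHypothesis ∧ (_root_.RiemannHypothesis → OddOneSignedWindows)) :=
  ⟨fun h => ⟨oddOneSignedWindows_imp_riemannHypothesis h, fun _ => h⟩, fun h => h.2 h.1⟩

/-- **The route consumes exactly RH.** `closes` invokes the crux only under the hypothesis `¬RH`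
(proof by contradiction), so what the route needs is `¬RH → S`; and `(¬RH → S) ↔ RH`. Hence no
weakening of the crux that still feeds `closes` is weaker than RH, and the conditional conjunct of
`crux_iff_rh_and_conditional` never enters the route. [folklore] -/
theorem not_rh_imp_crux_iff_rh :
    (¬ _root_.RiemannHypothesis → OddOneSignedWindows) ↔ _root_.RiemannHypothesis :=
  ⟨fun h => Classical.byContradiction fun hn => hn (oddOneSignedWindows_imp_riemannHypothesis (h hn)),
    fun h hn => absurd h hn⟩

/-- **The conditional conjunct is irrefutable short of RH**: refuting `RH → S` proves RH.
(So the judge's key-risk scenario "good windows bounded even under RH" can only ever be SUPPORTED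
heuristically, never proved, unless RH is proved first.) [folklore] -/
theorem rh_of_not_conditional (h : ¬ (_root_.RiemannHypothesis → OddOneSignedWindows)) :
    _root_.RiemannHypothesis :=
  Classical.byContradiction fun hn => h fun hr => absurd hr hn

/-- **Every concluding skeleton has a stub that implies RH on its own.** If `T → S` is proved
(RH-free glue), then `T → RH`. [folklore] -/
theorem stub_imp_rh {T : Prop} (h : T → OddOneSignedWindows) : T → _root_.RiemannHypothesis :=
  fun t => oddOneSignedWindows_imp_riemannHypothesis (h t)

/-- Two-stub form: in a skeleton `T₁ → T₂ → S` whose first stub is a theorem (the shape of both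
registered lines: `OriginLayerLemma`/`DiophantineSelection` landed, `OddBulkSignPattern`/
`DiophantineCore` open), the open stub implies RH by itself. [folklore] -/
theorem last_stub_imp_rh {T₁ T₂ : Prop} (h : T₁ → T₂ → OddOneSignedWindows) (h₁ : T₁) :
    T₂ → _root_.RiemannHypothesis :=
  fun t₂ => oddOneSignedWindows_imp_riemannHypothesis (h h₁ t₂)

/-- Conversely a stub implied by the crux is, modulo RH-free glue `T → S`, EQUIVALENT to the crux:
the shape of every registered RH-strength stub so far (`OddBulkSignPattern` by BulkIff p151717;
`NoOpposedReflections` by p150975; `DiophantineCore ≥ S`). [folklore] -/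
theorem stub_iff_crux {T : Prop} (h : T → OddOneSignedWindows) (h' : OddOneSignedWindows → T) :
    T ↔ OddOneSignedWindows := ⟨h, h'⟩

/-! ## 2. New census signatures (generation 1) -/

/-- **S7 `ClusterOneSignedVector` (strengthen/weaken probe; NOT filed).** Beyond every height some
window carries a REAL, ONE-SIGNED (on `(0,a)`), `L²`-normalised odd window function `v` whose Weil
energy along smooth odd approximants is within `η(a)` of the odd ground energy, `η → 0` — "the
near-null CLUSTER contains a one-signed vector" (inspiration note Q4: a Perron–Frobenius statement
for the nearly degenerate bottom family instead of "the" bottom eigenfunction).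
STATUS: TRUE IN SUBSTANCE AND USELESS — the normalised odd theta vector `Ĥ_a = −Φ′𝟙/‖·‖` is such a
`v` with `η(a) ≲ x^{13/4} e^{−πx}` (2001 Thm 3.2; the OddBartaFloor line's theta level), so the
statement carries no information about the minimiser; and Barta's floor needs the MINIMISER's sign
(a one-signed non-minimising `v` with Rayleigh quotient `≤ ε_od + η` bounds `ε_od` from ABOVE only:
`ε_od ≤ ⟨v, A v⟩`). The crux's entire content is "the minimiser itself is one of the one-signed
near-null vectors" (cf. Disproof `withoutMinimising_holds`, which drops minimisation altogether;
this sharpens it: even near-minimising to super-exponential accuracy is free). -/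
def ClusterOneSignedVector : Prop :=
  ∃ η : ℝ → ℝ, Tendsto η atTop (𝓝 0) ∧
    ∀ A : ℝ, ∃ a : ℝ, A ≤ a ∧ ∃ v : ℝ → ℂ, MemLp v 2 volume ∧ (∫ t, ‖v t‖ ^ 2 = (1 : ℝ)) ∧
      (∀ᵐ t : ℝ, t ∈ Ioo 0 a → (v t).im = 0 ∧ 0 ≤ (v t).re) ∧
      ∃ g : ℕ → ℝ → ℂ, (∀ n, IsWeilTest (g n) ∧ tsupport (g n) ⊆ Icc (-a) a ∧
          (∀ t, g n (-t) = -g n t) ∧ ∫ t, ‖g n t‖ ^ 2 = (1 : ℝ)) ∧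
        Tendsto (fun n => ∫ t, ‖g n t - v t‖ ^ 2) atTop (𝓝 0) ∧
        ∀ᶠ n in atTop, (weilQuadratic (g n)).re ≤ weilOddGroundEnergy a + η a

/-- **N7/D6 `EdgeTracePositive` (zone split probe; NOT filed).** Beyond every height some window
carries a real odd ground state that is `≥ 0` a.e. on `(0,a)` AND has a POSITIVE essential right
edge trace `c₊` (`Re u → c₊ > 0` essentially as `t → a⁻`). By the Hadamard variation formula of the
programme's literature (`d⁻ε/da = −(c₊² + c₋²)`, internal preprint "virial-monotone", Suzuki 2026
Thm 1.3) `c₊ ≠ 0` iff `ε_od` strictly decreases at `a`; the SIGN of `c₊` relative to the bulk is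
the edge-zone content of the crux (2001 R1). Census finding E7 (gen 1, `num/e7.py`): at
`a = 0.40…0.60` the real configuration is edge-positive, but the weight of the prime `2` that would
flip the edge sign exceeds `Λ(2)/√2` by a relative margin `0.75, 0.20, 0.037, 0.0031, 0.0004` —
collapsing like `ε_od(a)` itself: the edge sign is a "barely true" quantity of size `≍ ε_od(a)`
(NewmanConjecture-type thinness), so no perturbative/quantitative technique certifies it at large
`a` without resolving the near-null cluster exactly. Trivially `EdgeTracePositive → S`. -/
def EdgeTracePositive : Prop :=
  ∀ A : ℝ, ∃ a : ℝ, A ≤ a ∧ ∃ u : ℝ → ℂ, IsWeilOddGroundState a u ∧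
    (∀ᵐ t : ℝ, t ∈ Ioo 0 a → (u t).im = 0 ∧ 0 ≤ (u t).re) ∧
    ∃ c : ℝ, 0 < c ∧ ∀ ε : ℝ, 0 < ε → ∃ δ : ℝ, 0 < δ ∧
      ∀ᵐ t : ℝ, t ∈ Ioo (a - δ) a → |(u t).re - c| < ε

/-- `EdgeTracePositive → OddOneSignedWindows` (forget the trace). [folklore] -/
theorem oddOneSignedWindows_of_edgeTracePositive (h : EdgeTracePositive) : OddOneSignedWindows := by
  rw [oddOneSignedWindows_iff]
  intro A
  obtain ⟨a, hAa, u, hu, hsign, -⟩ := h A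
  exact ⟨a, hAa, u, hu, hsign⟩

/-- Hence `EdgeTracePositive → RH` as well (`stub_imp_rh`). [folklore] -/
theorem riemannHypothesis_of_edgeTracePositive (h : EdgeTracePositive) : _root_.RiemannHypothesis :=
  stub_imp_rh oddOneSignedWindows_of_edgeTracePositive h

end Summit.RiemannHypothesis.RiemannHypothesis.Cruxes.OddOneSignedWindows.Strategist2

end
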